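import Summits.AnomalousDissipation.AnomalousDissipation.Theorems.SolenoidalFractalHomogenisationLagrangianStepSidebandOwnSlotFeedback
import Summits.AnomalousDissipation.AnomalousDissipation.Theorems.SolenoidalFractalHomogenisationLagrangianStepSidebandMeanSlot
import HarnessLib

/-!
# K1L_D `stub_D1_residueTail` (registry v17, stmt-AnomalousDissipation-27980) — lane A1 brick D-1: THE COLINEAR SUCCESSOR SLOT — two-slot fibre
# Duhamel formula and the pair feedback kernel (helper; `--supports stmt-AnomalousDissipation-27980`)

Summits-side helper file of route `SolenoidalFractalHomogenisation` (prover seat `ad-sawtooth-k1loc-p1` g13; lane A of the tail certificate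
`Lines/onelevel-D1-tail-cert.md`, case D «colinear adjacent pair, forward orientation»).  Everything proved; no definitions, no named facts, no sorry.
Setting: two slots `j'` (source) and `j` (pickup) of a word `W₁` with the SAME wave vector `mⱼ = m_{j'}`, slot `j` starting where slot `j'` ends
(`startⱼ = start_{j'} + τ_{j'}`); `N` a periodic response of slot `j'`; `B = blockGen 𝔸 γ₁ mⱼ` over `ℝ`.
* `hasDerivAt_coordL_of_hoff` — the fibre derivative through `coordL` for ANY forcing term when the fibre `±mᵢ` of the active slot `i` is closed
  (`coordL_gen_of_slot`, p688466), freed from the own-source packaging of `hasDerivAt_coordL_of_slot`;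
* **`coordL_response_eq_duhamel_pair_self / _neg`** — for `t` in the pickup slot `j`:
  `(N t v)_{±m} = exp((t − start_{j'})B)(N start_{j'} v)_{±m} + ∫_{start_{j'}}^{startⱼ} exp((t−u)B)(−2πi env_{j'}(u) α_{j'}^{(±)} • P v) du` — the fibre `±m` is
  closed during BOTH slots (same `m`), the source of slot `j'` is off during slot `j`;
* **`feedback_response_pair_eq_of_mem_slot`** — with equal slot amplitudes `α_{j'} = αⱼ`, for `t` in slot `j`:
  `feedbackⱼ(t)(N t v) = (8π²|αⱼ|² envⱼ(t)) • ∫_{start_{j'}}^{startⱼ} env_{j'}(u) • exp((t−u)B)(P v) du + 2πi envⱼ(t) • (αⱼ • exp((t−start_{j'})B)(N start_{j'} v)_{−m} + ᾱⱼ • …_{m})`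
  — the fresh–fresh PAIR MEMORY kernel (the integrand of `D1ResidueCert.pairResp` before the slot-time substitution) plus the image of the state at the
  start of the source slot.
NOT a proof of any registered stub, of the crux, or of anomalous dissipation; rung leaf F-D1 infrastructure.
-/

set_option linter.dupNamespace false

noncomputable section

namespace Summit.AnomalousDissipation.AnomalousDissipation.Theorems.SolenoidalFractalHomogenisation.LagrangianStep.Sideband

open Set MeasureTheory Complex NormedSpace intervalIntegral
open scoped InnerProductSpace
open Literature.Analysis Literature.Analysis.FunctionSpaces Literature.Analysis.FunctionSpaces.Torus
open Literature.Analysis.FluidPDE Literature.Analysis.FluidPDE.Torus Literature.Analysis.FluidPDE.LatticeShear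
open Summit.AnomalousDissipation.AnomalousDissipation.Theorems.SolenoidalFractalHomogenisation.LagrangianStep.CellChain
  (linkCoeff eq_exp_add_integral_of_hasDerivAt)
open Summit.AnomalousDissipation.AnomalousDissipation.Theorems.SolenoidalFractalHomogenisation.PermissibleCarrier
  (start_nonneg start_add_tau_le_period period_pos)

variable {k₀ : ℕ}

/-! ## §1 The fibre derivative with an arbitrary forcing -/

/-- The amplitude on a closed fibre `±mᵢ` (slot `i` active alone at time `t`) of a curve `Y` with `Y' = F + gen(t) Y` solves
`(coordL m Y)' = coordL m F + blockGen m (coordL m Y)`. [cite: MajdaKramer1999, §2.2.1.3 (cell problem (49))] -/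
theorem hasDerivAt_coordL_of_hoff (W₁ : LatticeWord k₀) (𝔸 : Torus.Visc4 (Fin 3)) (γ₁ : ℝ) (R : ℕ) (i : Fin k₀) {t : ℝ}
    (hoff : ∀ j', j' ≠ i → slotEnvelope W₁ j' t = 0) {m : Fin 3 → ℤ} (hm : m = (W₁.phase i).m ∨ m = -(W₁.phase i).m)
    {Y : ℝ → Space R} {F : Space R} (hY : HasDerivAt Y (F + ((gen W₁ 𝔸 γ₁ R t).restrictScalars ℝ) (Y t)) t) :
    HasDerivAt (fun s => coordL R m (Y s)) (coordL R m F + blockGen 𝔸 γ₁ m (coordL R m (Y t))) t := by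
  have h := ((coordL R m).restrictScalars ℝ).hasFDerivAt.comp_hasDerivAt t hY
  have he : ((coordL R m).restrictScalars ℝ) (F + ((gen W₁ 𝔸 γ₁ R t).restrictScalars ℝ) (Y t)) =
      coordL R m F + blockGen 𝔸 γ₁ m (coordL R m (Y t)) := by
    rw [ContinuousLinearMap.coe_restrictScalars', map_add, ContinuousLinearMap.coe_restrictScalars', coordL_gen_of_slot W₁ 𝔸 γ₁ R i hoff hm]
  rw [he] at h
  exact h

/-! ## §2 The two-slot Duhamel formula on the common fibre -/

/-- **TWO-SLOT DUHAMEL FORMULA** (common fibre `m = mⱼ = m_{j'}`, sign `+`).  Let slot `j` start where slot `j'` ends and carry the same wave vector; let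
`N` be a periodic response of slot `j'`.  For `t ∈ [startⱼ, startⱼ + τⱼ]`:
`(N t v)_{m} = exp((t − start_{j'})·B)(N start_{j'} v)_{m} + ∫_{start_{j'}}^{startⱼ} exp((t − u)·B)(−2πi env_{j'}(u) α_{j'} • P_m v) du`, `B = blockGen 𝔸 γ₁ m` over `ℝ`.
[cite: Hale1980, Ch. III §1, Theorem 1.1 (variation of constants formula)] [cite: MajdaKramer1999, §2.2.1.3 (cell problem (49))] -/
theorem coordL_response_eq_duhamel_pair_self (W₁ : LatticeWord k₀) (𝔸 : Torus.Visc4 (Fin 3)) (γ₁ : ℝ) (R : ℕ) {j j' : Fin k₀}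
    (hmeq : (W₁.phase j').m = (W₁.phase j).m) (hadj : W₁.start j = W₁.start j' + (W₁.phase j').τ)
    {N : ℝ → (EuclideanSpace ℂ (Fin 3) →L[ℝ] Space R)} (hN : IsPeriodicResponse W₁ 𝔸 γ₁ R j' N) (hm : (W₁.phase j).m ∈ box R)
    (v : EuclideanSpace ℂ (Fin 3)) {t : ℝ} (ht : t ∈ Icc (W₁.start j) (W₁.start j + (W₁.phase j).τ)) :
    coordL R (W₁.phase j).m (N t v) =
      exp ((t - W₁.start j') • (blockGen 𝔸 γ₁ (W₁.phase j).m).restrictScalars ℝ) (coordL R (W₁.phase j).m (N (W₁.start j') v)) +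
      ∫ u in W₁.start j'..W₁.start j, exp ((t - u) • (blockGen 𝔸 γ₁ (W₁.phase j).m).restrictScalars ℝ)
        ((-(2 * Real.pi * Complex.I * ((slotEnvelope W₁ j' u : ℝ) : ℂ) * slotAmp W₁ j')) • transversalProj (W₁.phase j).m v) := by
  set m := (W₁.phase j).m with hmdef
  set s' := W₁.start j' with hs'
  set s := W₁.start j with hs
  set G : EuclideanSpace ℂ (Fin 3) →L[ℝ] EuclideanSpace ℂ (Fin 3) := -((blockGen 𝔸 γ₁ m).restrictScalars ℝ) with hG
  set x : ℝ → EuclideanSpace ℂ (Fin 3) := fun u => coordL R m (N u v) with hx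
  set f : ℝ → EuclideanSpace ℂ (Fin 3) := fun u =>
    (-(2 * Real.pi * Complex.I * ((slotEnvelope W₁ j' u : ℝ) : ℂ) * slotAmp W₁ j')) • transversalProj m v with hf
  have hL' := (W₁.phase j').τ_pos
  have hs'0 : 0 ≤ s' := start_nonneg W₁ j'
  have hsP : s + (W₁.phase j).τ ≤ W₁.period := start_add_tau_le_period W₁ j
  have hs't : s' ≤ t := by rw [hs'] ; linarith [ht.1, hadj]
  have hm' : m = (W₁.phase j').m := by rw [hmdef, hmeq]
  have hmj' : (W₁.phase j').m ∈ box R := hm' ▸ hm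
  have hxc : ContinuousOn x (Icc s' t) :=
    (continuousOn_coordL_response W₁ 𝔸 γ₁ R j' hN v m).mono (Icc_subset_Icc hs'0 (ht.2.trans hsP))
  have hfcont : Continuous f :=
    (((continuous_const.mul (Complex.continuous_ofReal.comp (continuous_slotEnvelope W₁ j'))).mul continuous_const).neg.smul continuous_const)
  have hfc : ContinuousOn f (Icc s' t) := hfcont.continuousOn
  have hxd : ∀ u ∈ Ioo s' t, HasDerivAt x (-(G (x u)) + f u) u := by
    intro u hu
    have huP : u ∈ Ico 0 W₁.period := ⟨hs'0.trans hu.1.le, lt_of_lt_of_le hu.2 (ht.2.trans hsP)⟩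
    have h1 := hasDerivAt_response_apply W₁ 𝔸 γ₁ R j' hN v huP
    have hsrc : coordL R m (source W₁ R j' u v) = f u := by
      simp only [hf]; rw [hm']; exact coordL_source_self W₁ j' u hmj' v
    -- which slot is active at `u`
    by_cases hus : u < s
    · have hslot : u ∈ Ico (W₁.start j') (W₁.start j' + (W₁.phase j').τ) := ⟨hu.1.le, by rw [← hadj]; exact hus⟩
      have hoff : ∀ i, i ≠ j' → slotEnvelope W₁ i u = 0 := fun i hi => slotEnvelope_eq_zero_of_mem_slot W₁ hi hslot
      have h2 := hasDerivAt_coordL_of_hoff W₁ 𝔸 γ₁ R j' hoff (Or.inl hm') h1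
      refine h2.congr_deriv ?_
      rw [hsrc, hG, neg_apply, ContinuousLinearMap.coe_restrictScalars', neg_neg, add_comm]
    · have hslot : u ∈ Ico (W₁.start j) (W₁.start j + (W₁.phase j).τ) := ⟨not_lt.mp hus, lt_of_lt_of_le hu.2 ht.2⟩
      have hoff : ∀ i, i ≠ j → slotEnvelope W₁ i u = 0 := fun i hi => slotEnvelope_eq_zero_of_mem_slot W₁ hi hslot
      have h2 := hasDerivAt_coordL_of_hoff W₁ 𝔸 γ₁ R j hoff (Or.inl hmdef) h1
      refine h2.congr_deriv ?_
      rw [hsrc, hG, neg_apply, ContinuousLinearMap.coe_restrictScalars', neg_neg, add_comm]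
  have hD := eq_exp_add_integral_of_hasDerivAt G hs't hxc hfc hxd
  simp only [hG, smul_neg, neg_neg] at hD
  -- the forcing is off after the source slot: split the integral at `s`
  have hEc : Continuous fun u : ℝ => exp ((t - u) • (blockGen 𝔸 γ₁ m).restrictScalars ℝ) (f u) :=
    (continuous_iff_continuousAt.2 fun u => (hasDerivAt_exp_smul_const ((blockGen 𝔸 γ₁ m).restrictScalars ℝ) u).continuousAt).comp
      (continuous_const.sub continuous_id) |>.clm_apply hfcont
  have hzero : ∫ u in s..t, exp ((t - u) • (blockGen 𝔸 γ₁ m).restrictScalars ℝ) (f u) = 0 := by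
    have hE : EqOn (fun u => exp ((t - u) • (blockGen 𝔸 γ₁ m).restrictScalars ℝ) (f u)) (fun _ => 0) (uIcc s t) := by
      intro u hu
      rw [uIcc_of_le ht.1] at hu
      have henv : slotEnvelope W₁ j' u = 0 :=
        slotEnvelope_eq_zero_of_end_le W₁ j' (by rw [← hadj]; exact hu.1) (hu.2.trans (ht.2.trans hsP))
      show exp ((t - u) • (blockGen 𝔸 γ₁ m).restrictScalars ℝ) (f u) = 0
      rw [hf]
      simp only [henv, Complex.ofReal_zero, mul_zero, zero_mul, neg_zero, zero_smul, map_zero]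
    rw [intervalIntegral.integral_congr hE, intervalIntegral.integral_zero]
  have hsplit : ∫ u in s'..t, exp ((t - u) • (blockGen 𝔸 γ₁ m).restrictScalars ℝ) (f u) =
      ∫ u in s'..s, exp ((t - u) • (blockGen 𝔸 γ₁ m).restrictScalars ℝ) (f u) := by
    rw [← intervalIntegral.integral_add_adjacent_intervals (hEc.intervalIntegrable s' s) (hEc.intervalIntegrable s t), hzero, add_zero]
  rw [hsplit] at hD
  exact hD

/-- **TWO-SLOT DUHAMEL FORMULA at `−m`** (conjugate amplitude `ᾱ_{j'}`; `blockGen (−m) = blockGen m`, `P_{−m} = P_m`).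
[cite: Hale1980, Ch. III §1, Theorem 1.1 (variation of constants formula)] [cite: MajdaKramer1999, §2.2.1.3 (cell problem (49))] -/
theorem coordL_response_eq_duhamel_pair_neg (W₁ : LatticeWord k₀) (𝔸 : Torus.Visc4 (Fin 3)) (γ₁ : ℝ) (R : ℕ) {j j' : Fin k₀}
    (hmeq : (W₁.phase j').m = (W₁.phase j).m) (hadj : W₁.start j = W₁.start j' + (W₁.phase j').τ)
    {N : ℝ → (EuclideanSpace ℂ (Fin 3) →L[ℝ] Space R)} (hN : IsPeriodicResponse W₁ 𝔸 γ₁ R j' N) (hm : -(W₁.phase j).m ∈ box R)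
    (v : EuclideanSpace ℂ (Fin 3)) {t : ℝ} (ht : t ∈ Icc (W₁.start j) (W₁.start j + (W₁.phase j).τ)) :
    coordL R (-(W₁.phase j).m) (N t v) =
      exp ((t - W₁.start j') • (blockGen 𝔸 γ₁ (W₁.phase j).m).restrictScalars ℝ) (coordL R (-(W₁.phase j).m) (N (W₁.start j') v)) +
      ∫ u in W₁.start j'..W₁.start j, exp ((t - u) • (blockGen 𝔸 γ₁ (W₁.phase j).m).restrictScalars ℝ)
        ((-(2 * Real.pi * Complex.I * ((slotEnvelope W₁ j' u : ℝ) : ℂ) * starRingEnd ℂ (slotAmp W₁ j'))) • transversalProj (W₁.phase j).m v) := by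
  set m := -(W₁.phase j).m with hmdef
  have hBm : blockGen 𝔸 γ₁ (W₁.phase j).m = blockGen 𝔸 γ₁ m := by rw [hmdef, blockGen_neg]
  have hPm : transversalProj (W₁.phase j).m = transversalProj m := by
    rw [hmdef]; exact ContinuousLinearMap.ext fun z => (transversalProj_neg_wave _ z).symm
  rw [hBm, hPm]
  set s' := W₁.start j' with hs'
  set s := W₁.start j with hs
  set G : EuclideanSpace ℂ (Fin 3) →L[ℝ] EuclideanSpace ℂ (Fin 3) := -((blockGen 𝔸 γ₁ m).restrictScalars ℝ) with hG
  set x : ℝ → EuclideanSpace ℂ (Fin 3) := fun u => coordL R m (N u v) with hx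
  set f : ℝ → EuclideanSpace ℂ (Fin 3) := fun u =>
    (-(2 * Real.pi * Complex.I * ((slotEnvelope W₁ j' u : ℝ) : ℂ) * starRingEnd ℂ (slotAmp W₁ j'))) • transversalProj m v with hf
  have hL' := (W₁.phase j').τ_pos
  have hs'0 : 0 ≤ s' := start_nonneg W₁ j'
  have hsP : s + (W₁.phase j).τ ≤ W₁.period := start_add_tau_le_period W₁ j
  have hs't : s' ≤ t := by rw [hs'] ; linarith [ht.1, hadj]
  have hm' : m = -(W₁.phase j').m := by rw [hmdef, hmeq]
  have hmj' : -(W₁.phase j').m ∈ box R := hm' ▸ hm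
  have hxc : ContinuousOn x (Icc s' t) :=
    (continuousOn_coordL_response W₁ 𝔸 γ₁ R j' hN v m).mono (Icc_subset_Icc hs'0 (ht.2.trans hsP))
  have hfcont : Continuous f :=
    (((continuous_const.mul (Complex.continuous_ofReal.comp (continuous_slotEnvelope W₁ j'))).mul continuous_const).neg.smul continuous_const)
  have hfc : ContinuousOn f (Icc s' t) := hfcont.continuousOn
  have hxd : ∀ u ∈ Ioo s' t, HasDerivAt x (-(G (x u)) + f u) u := by
    intro u hu
    have huP : u ∈ Ico 0 W₁.period := ⟨hs'0.trans hu.1.le, lt_of_lt_of_le hu.2 (ht.2.trans hsP)⟩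
    have h1 := hasDerivAt_response_apply W₁ 𝔸 γ₁ R j' hN v huP
    have hsrc : coordL R m (source W₁ R j' u v) = f u := by
      simp only [hf]; rw [hm']; exact coordL_source_neg W₁ j' u hmj' v
    by_cases hus : u < s
    · have hslot : u ∈ Ico (W₁.start j') (W₁.start j' + (W₁.phase j').τ) := ⟨hu.1.le, by rw [← hadj]; exact hus⟩
      have hoff : ∀ i, i ≠ j' → slotEnvelope W₁ i u = 0 := fun i hi => slotEnvelope_eq_zero_of_mem_slot W₁ hi hslot
      have h2 := hasDerivAt_coordL_of_hoff W₁ 𝔸 γ₁ R j' hoff (Or.inr hm') h1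
      refine h2.congr_deriv ?_
      rw [hsrc, hG, neg_apply, ContinuousLinearMap.coe_restrictScalars', neg_neg, add_comm]
    · have hslot : u ∈ Ico (W₁.start j) (W₁.start j + (W₁.phase j).τ) := ⟨not_lt.mp hus, lt_of_lt_of_le hu.2 ht.2⟩
      have hoff : ∀ i, i ≠ j → slotEnvelope W₁ i u = 0 := fun i hi => slotEnvelope_eq_zero_of_mem_slot W₁ hi hslot
      have h2 := hasDerivAt_coordL_of_hoff W₁ 𝔸 γ₁ R j hoff (Or.inr hmdef) h1
      refine h2.congr_deriv ?_
      rw [hsrc, hG, neg_apply, ContinuousLinearMap.coe_restrictScalars', neg_neg, add_comm]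
  have hD := eq_exp_add_integral_of_hasDerivAt G hs't hxc hfc hxd
  simp only [hG, smul_neg, neg_neg] at hD
  have hEc : Continuous fun u : ℝ => exp ((t - u) • (blockGen 𝔸 γ₁ m).restrictScalars ℝ) (f u) :=
    (continuous_iff_continuousAt.2 fun u => (hasDerivAt_exp_smul_const ((blockGen 𝔸 γ₁ m).restrictScalars ℝ) u).continuousAt).comp
      (continuous_const.sub continuous_id) |>.clm_apply hfcont
  have hzero : ∫ u in s..t, exp ((t - u) • (blockGen 𝔸 γ₁ m).restrictScalars ℝ) (f u) = 0 := by
    have hE : EqOn (fun u => exp ((t - u) • (blockGen 𝔸 γ₁ m).restrictScalars ℝ) (f u)) (fun _ => 0) (uIcc s t) := by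
      intro u hu
      rw [uIcc_of_le ht.1] at hu
      have henv : slotEnvelope W₁ j' u = 0 :=
        slotEnvelope_eq_zero_of_end_le W₁ j' (by rw [← hadj]; exact hu.1) (hu.2.trans (ht.2.trans hsP))
      show exp ((t - u) • (blockGen 𝔸 γ₁ m).restrictScalars ℝ) (f u) = 0
      rw [hf]
      simp only [henv, Complex.ofReal_zero, mul_zero, zero_mul, neg_zero, zero_smul, map_zero]
    rw [intervalIntegral.integral_congr hE, intervalIntegral.integral_zero]
  have hsplit : ∫ u in s'..t, exp ((t - u) • (blockGen 𝔸 γ₁ m).restrictScalars ℝ) (f u) =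
      ∫ u in s'..s, exp ((t - u) • (blockGen 𝔸 γ₁ m).restrictScalars ℝ) (f u) := by
    rw [← intervalIntegral.integral_add_adjacent_intervals (hEc.intervalIntegrable s' s) (hEc.intervalIntegrable s t), hzero, add_zero]
  rw [hsplit] at hD
  exact hD

/-! ## §3 The pair feedback kernel -/

set_option maxHeartbeats 400000 in
/-- **`feedbackⱼ ∘ N_{j'}` DURING THE PICKUP SLOT `j`** (colinear successor, equal slot amplitudes).  For `t ∈ [startⱼ, startⱼ + τⱼ]`:
`feedbackⱼ(t)(N t v) = (8π²|αⱼ|² envⱼ(t)) • ∫_{start_{j'}}^{startⱼ} env_{j'}(u) • exp((t−u)·B)(P_m v) du`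
`+ 2πi envⱼ(t) • (αⱼ • exp((t−start_{j'})B)(N start_{j'} v)_{−m} + ᾱⱼ • exp((t−start_{j'})B)(N start_{j'} v)_{m})`.
[cite: MajdaKramer1999, §2.2.1.3 (55) (effective diffusivity as a cell average)] [cite: Hale1980, Ch. III §1, Theorem 1.1] -/
theorem feedback_response_pair_eq_of_mem_slot (W₁ : LatticeWord k₀) (𝔸 : Torus.Visc4 (Fin 3)) (γ₁ : ℝ) (R : ℕ) {j j' : Fin k₀}
    (hmeq : (W₁.phase j').m = (W₁.phase j).m) (hα : slotAmp W₁ j' = slotAmp W₁ j) (hadj : W₁.start j = W₁.start j' + (W₁.phase j').τ)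
    {N : ℝ → (EuclideanSpace ℂ (Fin 3) →L[ℝ] Space R)} (hN : IsPeriodicResponse W₁ 𝔸 γ₁ R j' N)
    (hm : (W₁.phase j).m ∈ box R) (hm' : -(W₁.phase j).m ∈ box R) (v : EuclideanSpace ℂ (Fin 3)) {t : ℝ}
    (ht : t ∈ Icc (W₁.start j) (W₁.start j + (W₁.phase j).τ)) :
    feedback W₁ R j t (N t v) =
      (((8 * Real.pi ^ 2 * Complex.normSq (slotAmp W₁ j) * slotEnvelope W₁ j t : ℝ) : ℂ)) •
        (∫ u in W₁.start j'..W₁.start j, ((slotEnvelope W₁ j' u : ℝ) : ℂ) •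
          exp ((t - u) • (blockGen 𝔸 γ₁ (W₁.phase j).m).restrictScalars ℝ) (transversalProj (W₁.phase j).m v)) +
      (2 * Real.pi * Complex.I * ((slotEnvelope W₁ j t : ℝ) : ℂ)) •
        (slotAmp W₁ j • exp ((t - W₁.start j') • (blockGen 𝔸 γ₁ (W₁.phase j).m).restrictScalars ℝ) (coordL R (-(W₁.phase j).m) (N (W₁.start j') v)) +
          starRingEnd ℂ (slotAmp W₁ j) •
            exp ((t - W₁.start j') • (blockGen 𝔸 γ₁ (W₁.phase j).m).restrictScalars ℝ) (coordL R (W₁.phase j).m (N (W₁.start j') v))) := by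
  set m := (W₁.phase j).m with hmdef
  set Bℝ := (blockGen 𝔸 γ₁ m).restrictScalars ℝ with hB
  set α := slotAmp W₁ j with hαdef
  set env : ℝ → ℝ := slotEnvelope W₁ j with henv
  set env' : ℝ → ℝ := slotEnvelope W₁ j' with henv'
  set P := transversalProj m with hP
  set s' := W₁.start j' with hs'
  set s := W₁.start j with hs
  have hDp := coordL_response_eq_duhamel_pair_self W₁ 𝔸 γ₁ R hmeq hadj hN hm v ht
  have hDn := coordL_response_eq_duhamel_pair_neg W₁ 𝔸 γ₁ R hmeq hadj hN hm' v ht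
  rw [hα] at hDp hDn
  rw [feedback_apply, hDp, hDn]
  simp only [← hmdef, ← hB, ← hαdef, ← henv, ← henv', ← hP, ← hs', ← hs]
  have hEc : Continuous fun u : ℝ => exp ((t - u) • Bℝ) (P v) := continuous_exp_sub_smul_apply Bℝ t (P v)
  have henvc : Continuous fun u : ℝ => ((env' u : ℝ) : ℂ) := Complex.continuous_ofReal.comp (continuous_slotEnvelope W₁ j')
  obtain ⟨f₁, hf₁⟩ : ∃ f : ℝ → EuclideanSpace ℂ (Fin 3), f = fun u =>
      (-(2 * Real.pi * Complex.I * ((env' u : ℝ) : ℂ) * starRingEnd ℂ α)) • exp ((t - u) • Bℝ) (P v) := ⟨_, rfl⟩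
  obtain ⟨f₂, hf₂⟩ : ∃ f : ℝ → EuclideanSpace ℂ (Fin 3), f = fun u =>
      (-(2 * Real.pi * Complex.I * ((env' u : ℝ) : ℂ) * α)) • exp ((t - u) • Bℝ) (P v) := ⟨_, rfl⟩
  obtain ⟨g, hg⟩ : ∃ f : ℝ → EuclideanSpace ℂ (Fin 3), f = fun u => ((env' u : ℝ) : ℂ) • exp ((t - u) • Bℝ) (P v) := ⟨_, rfl⟩
  have hc₁ : Continuous f₁ := by rw [hf₁]; exact ((continuous_const.mul henvc).mul continuous_const).neg.smul hEc
  have hc₂ : Continuous f₂ := by rw [hf₂]; exact ((continuous_const.mul henvc).mul continuous_const).neg.smul hEc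
  have hIp : ∫ u in s'..s, exp ((t - u) • Bℝ) ((-(2 * Real.pi * Complex.I * ((env' u : ℝ) : ℂ) * α)) • P v) = ∫ u in s'..s, f₂ u :=
    integral_congr fun u _ => by rw [hf₂]; simp only [hB, exp_restrictScalars_smul]
  have hIn : ∫ u in s'..s, exp ((t - u) • Bℝ) ((-(2 * Real.pi * Complex.I * ((env' u : ℝ) : ℂ) * starRingEnd ℂ α)) • P v) =
      ∫ u in s'..s, f₁ u :=
    integral_congr fun u _ => by rw [hf₁]; simp only [hB, exp_restrictScalars_smul]
  have hG : ∫ u in s'..s, ((env' u : ℝ) : ℂ) • exp ((t - u) • Bℝ) (P v) = ∫ u in s'..s, g u :=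
    integral_congr fun u _ => by rw [hg]
  rw [hIp, hIn, hG]
  have hpt : ∀ u, (2 * Real.pi * Complex.I * ((env t : ℝ) : ℂ)) • (α • f₁ u + starRingEnd ℂ α • f₂ u) =
      (((8 * Real.pi ^ 2 * Complex.normSq α * env t : ℝ) : ℂ)) • g u := by
    intro u
    rw [hf₁, hf₂, hg]
    simp only [smul_smul, ← add_smul]
    congr 1
    rw [hαdef, slotAmp_cross W₁ j]
    push_cast
    linear_combination (-(8:ℂ) * Real.pi ^ 2 * (env t : ℂ) * (env' u : ℂ) * (Complex.normSq (slotAmp W₁ j) : ℂ)) * Complex.I_mul_I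
  have hi₁ : IntervalIntegrable (fun u => α • f₁ u) volume s' s := (hc₁.const_smul α).intervalIntegrable _ _
  have hi₂ : IntervalIntegrable (fun u => starRingEnd ℂ α • f₂ u) volume s' s := (hc₂.const_smul (starRingEnd ℂ α)).intervalIntegrable _ _
  have e1 : ∫ u in s'..s, (α • f₁ u + starRingEnd ℂ α • f₂ u) = (α • ∫ u in s'..s, f₁ u) + starRingEnd ℂ α • ∫ u in s'..s, f₂ u := by
    rw [intervalIntegral.integral_add hi₁ hi₂, intervalIntegral.integral_smul, intervalIntegral.integral_smul]
  have e2 : ∫ u in s'..s, (2 * Real.pi * Complex.I * ((env t : ℝ) : ℂ)) • (α • f₁ u + starRingEnd ℂ α • f₂ u) =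
      (2 * Real.pi * Complex.I * ((env t : ℝ) : ℂ)) • ∫ u in s'..s, (α • f₁ u + starRingEnd ℂ α • f₂ u) := by
    rw [intervalIntegral.integral_smul]
  have e3 : ∫ u in s'..s, (2 * Real.pi * Complex.I * ((env t : ℝ) : ℂ)) • (α • f₁ u + starRingEnd ℂ α • f₂ u) =
      ∫ u in s'..s, (((8 * Real.pi ^ 2 * Complex.normSq α * env t : ℝ) : ℂ)) • g u :=
    integral_congr fun u _ => hpt u
  have e4 : ∫ u in s'..s, (((8 * Real.pi ^ 2 * Complex.normSq α * env t : ℝ) : ℂ)) • g u =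
      (((8 * Real.pi ^ 2 * Complex.normSq α * env t : ℝ) : ℂ)) • ∫ u in s'..s, g u := by
    rw [intervalIntegral.integral_smul]
  have key : (2 * Real.pi * Complex.I * ((env t : ℝ) : ℂ)) • ((α • ∫ u in s'..s, f₁ u) + starRingEnd ℂ α • ∫ u in s'..s, f₂ u) =
      (((8 * Real.pi ^ 2 * Complex.normSq α * env t : ℝ) : ℂ)) • ∫ u in s'..s, g u := by
    rw [← e1, ← e2, e3, e4]
  rw [← key, ← smul_add]
  refine congrArg (fun y => (2 * Real.pi * Complex.I * ((env t : ℝ) : ℂ)) • y) ?_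
  rw [smul_add, smul_add]
  exact (add_add_add_comm _ _ _ _).trans (add_comm _ _)

end Summit.AnomalousDissipation.AnomalousDissipation.Theorems.SolenoidalFractalHomogenisation.LagrangianStep.Sideband

end
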